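import Mathlib
import Summits.NavierStokesRegularity.NavierStokesRegularity.Theorems.EulerZoomLiouvillePowerGaugeEulerLiouvilleNeedleWaitingTimeMember
import Summits.NavierStokesRegularity.NavierStokesRegularity.Theorems.EulerZoomLiouvillePowerGaugeEulerLiouvilleNeedleClockThreshold
import Summits.NavierStokesRegularity.NavierStokesRegularity.Theorems.EulerZoomLiouvillePowerGaugeEulerLiouvilleNeedleStrongThinFastExits
import HarnessLib.Audit

/-!
# Crux E `EulerZoomLiouville.PowerGaugeEulerLiouville` — THE WAITING-TIME EXPONENT `2 + ρ` AT MEMBER LEVEL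
# (ROUND-38 (T_pow) ∘ (K″)): a residence clock of strength `o(R^{2+ρ})` kills the `C²` needle

Route №10 `EulerZoomLiouville` (NavierStokesRegularity), crux E = stmt-NavierStokesRegularity-19832, registered residue
`stub_selfSimilarC2Needle`; memo ROUND-38 of the cell `ns-regularity-ideate` (text custody nsreg-p2 g33).  By-name assembly of
(K″) = the STRONG thin fast exits of a `C¹` profile with polynomial ball budgets (nsreg-p2 t39d,
`NeedleFastSetMeasure.thinFastExits_strong'`: size `C R⁴ e^{−βR^{2+ρ}}`, `β > 0` from the band law) with this seat's
power-clock threshold `NeedleRace.curl_eq_zero_of_powerClock_of_strongThinExits` (`…NeedleClockThreshold`):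

* **`selfSimilar_ae_eq_zero_of_subcriticalClockC2`** — crux hypotheses verbatim (`0 < ρ ≤ ½`) + exact self-similarity with
  a `C²` profile `V` + a RESIDENCE CLOCK OF STRENGTH `c′R^{2+ρ}` FOR EVERY `c′ > 0` (around every vortical point a ball at most
  half of whose labels stay in `‖·‖ ≤ 2R` during backward similarity time `c′R^{2+ρ}`, all large `R`, every cut-off copy)
  ⇒ `u = 0` a.e.  This is ROUND-38's WAITING-TIME EXPONENT: any symmetry-free clock `o(R^{2+ρ})` closes THE ONE STATEMENT's
  `C²` needle; the axisymmetric swirl-free Casimir gives `O(log R)`; in general none is known.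

NOT NS, not E: a conditional threshold; 19832 OPEN.  References: Constantin–Ignatova–Vicol arXiv:2602.17570 §3.4–§3.5
[ConstantinIgnatovaVicol2026Putative]; Maz'ya, Sobolev Spaces §2.2.3 (capacity–area, behind t39b) [folklore].
-/

noncomputable section

-- the summit and its single problem share the name `NavierStokesRegularity` (D-0017 nested layout)
set_option linter.dupNamespace false

open Set Filter Topology Metric Function MeasureTheory InnerProductSpace
open scoped RealInnerProductSpace NNReal ENNReal

namespace Summit.NavierStokesRegularity.NavierStokesRegularity.Theorems.PowerGaugeEulerLiouville.NeedleRace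

open Literature.Analysis Literature.Analysis.FluidPDE
open Summit.NavierStokesRegularity.NavierStokesRegularity.Theorems.PowerGaugeEulerLiouville

variable {V : EuclideanSpace ℝ (Fin 3) → EuclideanSpace ℝ (Fin 3)}

/-- **THE WAITING-TIME EXPONENT AT MEMBER LEVEL (ROUND-38 (T_pow) ∘ (K″)).**  An exactly self-similar member of the window
class (`0 < ρ ≤ ½`, crux hypotheses verbatim) with a `C²` velocity profile carrying, for EVERY `c′ > 0`, a residence clock of
strength `c′R^{2+ρ}` is trivial. [cite: ConstantinIgnatovaVicol2026Putative, §3.5] -/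
theorem selfSimilar_ae_eq_zero_of_subcriticalClockC2 {ρ : ℝ} (hρ : 0 < ρ) (hρ1 : ρ ≤ 1 / 2)
    {u : ℝ → EuclideanSpace ℝ (Fin 3) → EuclideanSpace ℝ (Fin 3)} {p : ℝ → EuclideanSpace ℝ (Fin 3) → ℝ}
    {H : ℝ → EuclideanSpace ℝ (Fin 3) → EuclideanSpace ℝ (Fin 3) →L[ℝ] EuclideanSpace ℝ (Fin 3)} {c : ℝ≥0}
    (hsw : IsSuitableWeakSolutionOn (slab (EuclideanSpace ℝ (Fin 3)) (Iio 0) isOpen_Iio) 0 0 u p)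
    (hH : HasWeakSpatialGradientOn (slab (EuclideanSpace ℝ (Fin 3)) (Iio 0) isOpen_Iio) u H)
    (hgauge : ∀ a : ℝ, 0 < a →
      ENNReal.ofReal (a ^ (2 * ρ)) * cknA a (0 : ℝ × EuclideanSpace ℝ (Fin 3)) u +
          ENNReal.ofReal (a ^ ρ) * cknE a (0 : ℝ × EuclideanSpace ℝ (Fin 3)) H +
        ENNReal.ofReal (a ^ (2 * ρ)) * cknD a (0 : ℝ × EuclideanSpace ℝ (Fin 3)) p ≤ (c : ℝ≥0∞))
    {P : EuclideanSpace ℝ (Fin 3) → ℝ}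
    (hu : ∀ τ : ℝ, τ < 0 → u τ = selfSimilarCollapse (1 / (2 + ρ)) 0 V τ)
    (hp : ∀ τ : ℝ, τ < 0 → p τ = selfSimilarCollapsePressure (1 / (2 + ρ)) 0 P τ)
    (hV : ContDiff ℝ 2 V)
    (hclock : ∀ c' : ℝ, 0 < c' → ∀ x₀ : EuclideanSpace ℝ (Fin 3), curl V x₀ ≠ 0 → ∃ r : ℝ, 0 < r ∧ ∃ R₀ : ℝ,
      ∀ R : ℝ, R₀ ≤ R → ∀ (V' : EuclideanSpace ℝ (Fin 3) → EuclideanSpace ℝ (Fin 3)) (K Rbig : ℝ), ContDiff ℝ 2 V' →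
        (∀ y, ‖fderiv ℝ V' y‖ ≤ K) → 2 * R < Rbig →
        (∀ w ∈ ball (0 : EuclideanSpace ℝ (Fin 3)) Rbig, V' w = V w) →
        (volume (ball x₀ r ∩ {y | ∀ σ ∈ Icc 0 (c' * R ^ (2 + ρ)),
          ‖ODE.evolutionMap (fun _ : ℝ => selfSimilarTransport (1 / (2 + ρ)) 0 V') 0 (-σ) y‖ ≤ 2 * R})).toReal ≤
          (volume (ball x₀ r)).toReal / 2) :
    uncurry u =ᵐ[volume.restrict (Iio (0 : ℝ) ×ˢ (univ : Set (EuclideanSpace ℝ (Fin 3))))] 0 := by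
  have hρ1' : ρ < 1 := by linarith
  have h2ρ : (0 : ℝ) < 2 + ρ := by linarith
  have hγ : (0 : ℝ) < 1 / (2 + ρ) := one_div_pos.2 h2ρ
  have h1ρ : 0 ≤ 1 - ρ := by linarith
  have hA : ∀ a : ℝ, 0 < a → ENNReal.ofReal (a ^ (2 * ρ)) *
      cknA a (0 : ℝ × EuclideanSpace ℝ (Fin 3)) u ≤ (c : ℝ≥0∞) :=
    fun a ha => le_trans (le_trans le_self_add le_self_add) (hgauge a ha)
  -- divergence-free profile and the class budgets on closed balls (as in `thinFastExits_of_selfSimilarC2`)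
  obtain ⟨hdiv, -⟩ := thinFastExits_of_selfSimilarC2 hρ hρ1 hsw hH hgauge hu hp hV
  obtain ⟨hA', hE'⟩ :=
    NeedleThinCore.selfSimilar_needle_inputs hρ hρ1' hsw hH hgauge hu hp (hV.of_le one_le_two)
  have hbA : ∀ L : ℝ, 1 ≤ L →
      ∫⁻ z in closedBall (0 : EuclideanSpace ℝ (Fin 3)) L, ‖V z‖ₑ ^ 2 ≤
        ENNReal.ofReal ((c : ℝ) * 2 ^ (1 - 2 * ρ) * L ^ (1 - 2 * ρ)) := by
    intro L hL
    have hL0 : 0 < L := by linarith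
    calc ∫⁻ z in closedBall (0 : EuclideanSpace ℝ (Fin 3)) L, ‖V z‖ₑ ^ 2
        ≤ ∫⁻ z in ball (0 : EuclideanSpace ℝ (Fin 3)) (2 * L), ‖V z‖ₑ ^ 2 :=
          lintegral_mono_set (closedBall_subset_ball (by linarith))
      _ ≤ (c : ℝ≥0∞) * ENNReal.ofReal ((2 * L) ^ (1 - 2 * ρ)) := hA' (2 * L) (by linarith)
      _ = ENNReal.ofReal ((c : ℝ) * 2 ^ (1 - 2 * ρ) * L ^ (1 - 2 * ρ)) := by
          rw [Real.mul_rpow two_pos.le hL0.le, ← ENNReal.ofReal_coe_nnreal,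
            ← ENNReal.ofReal_mul (NNReal.coe_nonneg c)]
          congr 1
          ring
  have hE0 : 0 ≤ (1 - ρ) / (2 + ρ) * (c : ℝ) := by positivity
  have hbE : ∀ L : ℝ, 1 ≤ L →
      ∫⁻ z in closedBall (0 : EuclideanSpace ℝ (Fin 3)) L, ‖fderiv ℝ V z‖ₑ ^ 2 ≤
        ENNReal.ofReal ((1 - ρ) / (2 + ρ) * (c : ℝ) * L ^ (1 - ρ)) :=
    fun L hL => lintegral_fderiv_sq_closedBall_le hρ1' hE0 hE' hL
  -- (K″): strong thin exits
  obtain ⟨β, hβ, C, hC, hthinS⟩ :=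
    NeedleFastSetMeasure.thinFastExits_strong' (hV.of_le (by norm_num)) hγ hρ.le hρ1 (by positivity) hE0 hbA hbE
  -- the clock at strength `c′ = β/(12γ)`, so that `6γc′ = β/2 < β`
  set c' : ℝ := β / (12 * (1 / (2 + ρ))) with hc'
  have hc'0 : 0 < c' := by rw [hc']; positivity
  have hβc : 6 * (1 / (2 + ρ)) * c' < β := by
    rw [hc']
    field_simp
    nlinarith [hβ, h2ρ]
  have hc0 : ∀ x, curl V x = 0 :=
    curl_eq_zero_of_powerClock_of_strongThinExits (γ := 1 / (2 + ρ)) (e := 2 + ρ) hV hdiv hγ one_pos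
      (by linarith) hC hthinS hc'0.le hβc (hclock c' hc'0)
  exact Loc.selfSimilar_ae_eq_zero_of_irrotationalC2_profile hρ hsw.distributional hA hu hV hc0

end Summit.NavierStokesRegularity.NavierStokesRegularity.Theorems.PowerGaugeEulerLiouville.NeedleRace

end
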